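import Literature.NumberTheory.LFunctions.FeketePolyaKernelCertificatesResidueWrappers
import HarnessLib

/-!
# No real zero for real primitive characters of conductor `10065 ≤ q ≤ 10067`: the Fekete–Pólya rows, in the kernel

Topic `Literature/NumberTheory/LFunctions`; namespace `Literature.NumberTheory.LFunctions`. THEOREMS only (no
definition, no named fact, no `sorry`; standard axioms): one PUBLIC theorem **`noRealZero{Odd,Even}_fp_<q>`** per
fundamental discriminant `D`, `|D| = q ∈ [10065, 10067]`, that admits a Fekete–Pólya witness — for every primitive
quadratic `χ` mod `q` of the parity of `D` and every `σ ∈ (0, 1)`, `L(σ, χ) ≠ 0` (statement shape of the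
`interval_cases` bullets of the `NoRealZero{Odd,Even}…` range files, so a range assembly cites them by name).
Cell `parity-realchar`, kernel floor of the wide column (TARGET §2 row 19), Fekete–Pólya lane (seat prover-2).

Method: `FeketePolyaKernelCertificates{HigherOrder,ResidueTables,ResidueWrappers}.lean` — the iterated partial
sums of order `k` of the induced character `χ↑(q·w)` are non-negative over one period (`runOK` at order `2`,
`fpRun v q w k` at orders `3 … 12`, decided in the kernel; values of `χ` from the quadratic-residue bitsets of the
prime factors of the conductor — the factor list is part of each certificate, primality by `norm_num`),
hence `ℜL(σ, χ↑(q·w)) > 0` (Fekete–Pólya 1912 / MV §11.2.1 Exercise 7) and `L(σ, χ) ≠ 0` (positive Euler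
factors, Exercise 8).  Witnesses `(w, k)` = the cheapest in the exact integer scan of this seat
(`HOME/parity-realchar-prover-2/fp-witnesses-6001-20000.tsv`; no kit).  1 characters in this file
(est. 7 kernel-s).  NOT covered here (no Fekete–Pólya witness with `w ≤ 40`, `q·w ≤ 4·10⁵`, `k ≤ 12`,
or deferred as too costly for this engine) — left to the truncation certificates of the companion lane:
`-10067`.

## References

* H. L. Montgomery, R. C. Vaughan, *Multiplicative Number Theory I*, CUP 2007, §9.3 Thm 9.13, §11.2.1
  Exercises 7–8. [MontgomeryVaughan2007]
* M. Fekete, G. Pólya, *Über ein Problem von Laguerre*, Rend. Circ. Mat. Palermo 34 (1912) 89–120. [FeketePolya1912]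
-/

namespace Literature.NumberTheory.LFunctions

open FeketePolyaKernel

set_option maxHeartbeats 800000 in
/-- `D = 10065`: the even character `(·/10065)` of conductor `10065` (`10065`: 3 · 5 · 11 · 61) — Fekete–Pólya witness of order `2` (`runOK`) along the primitive modulus; est. `7` kernel-s. [cite: MontgomeryVaughan2007, §11.2.1 Exercises 7 (g), 8] -/
theorem noRealZeroEven_fp_10065 :
    ∀ χ : DirichletCharacter ℂ 10065, χ.IsQuadratic → χ.IsPrimitive → χ.Even →
      ∀ σ : ℝ, 0 < σ → σ < 1 → χ.LFunction σ ≠ 0 :=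
  good_even_of_odd_r2 [3, 5, 11, 61] (by norm_num) (by decide) (by decide) 1 (by decide) (by decide +kernel)

end Literature.NumberTheory.LFunctions
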